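import Summits.Ventures.QEC.Basic.HypergraphProductCensus
import Literature.InformationTheory.QuantumCodes.HypergraphProductSectorDistances

/-!
# `HGP(H₁, H₂)` with ONE seed of full row rank: `D = min(d₁, d₂)` exactly (sector form), and its census corollaries

LADDER-QEC (venture cell `qec`, PARTITION v2.3 item 04.HGPK), `Summits/Ventures/QEC/Basic/`. Companion to
`Basic/HypergraphProductCensus.lean`. Tillich–Zémor's `D ≥ min(d₁, d₂, d₁ᵀ, d₂ᵀ)` (Theorem 9) is not tight when
exactly one seed has full row rank and the other seed's transpose distance is small (e.g. the census row
`HGP_hamx3_x_gal34_n12_c2897`: TZ gives `3 ≤ D ≤ 4`, the true value is `4`). The SECTOR form of the distance —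
Zeng–Pryadko 2020, Thm 17 ("Künneth theorem with a distance", length-two case): `d_Z = min(d₁·[k₂ ≥ 1], d₂ᵀ·[k₁ᵀ ≥ 1])`,
`d_X = min(d₂·[k₁ ≥ 1], d₁ᵀ·[k₂ᵀ ≥ 1])`, lower-bound half PROVED in
`Literature/InformationTheory/QuantumCodes/HypergraphProductSectorDistances.lean` — closes the gap:

* `HGP.HX_swap`, `HGP.HZ_swap`, `HGP.distance_swap` — exchanging the seeds exchanges `X ↔ Z` up to relabelling,
  so `D(HGP(H₁,H₂)) = D(HGP(H₂,H₁))`;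
* `HGP.distance_ge_min_of_transpose_left / _right` — if `ker H₁ᵀ = 0` (resp. `ker H₂ᵀ = 0`) then `D ≥ min(d₁, d₂)`;
* `HGP.distance_eq_min_of_transpose` — with both seed codes nonzero, `D = min(d₁, d₂)` (TZ Lemma 10 for `≤`);
  contains `HGP.distance_eq_min` (both seeds full rank, Breuckmann–Eberhardt §4.1);
* census corollaries `HGP.isCode_of_rank_left / _right`: rank certificates + the two classical distances
  `d(ker H₁)`, `d(ker H₂)` give `(HGP.code H₁ H₂).IsCode n k (min d₁ d₂)` — no transpose-distance certificate.

With this file EVERY hypergraph-product census row with `k ≥ 1` is determined by classical seed certificates: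
both seeds full rank or one full rank (this file), none full rank (`HGP.isCode_of_min_min`). HONEST FRAMING: theorems
about all pairs of binary matrices; instances live in `Census/HGP/*.lean`.

References: [ZengPryadko2020] Zeng–Pryadko, Phys. Rev. A 102, 062402 (2020) = arXiv:2007.12152, Thm 17 (chunk p0018
L1-12) and §4.1 (chunk p0015 L40-46); [TillichZemor2014] Tillich–Zémor, IEEE Trans. IT 60 (2014) 1193 =
arXiv:0903.0566v1, §3–4, Prop. 2, Thm 7, Lemma 10.
-/

namespace Summit.Ventures.QEC.HGP

open Matrix Module
open scoped Kronecker
open Literature.InformationTheory.QuantumCodes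
open Literature.InformationTheory.Coding (minDist minDist_bot minDist_le_hammingNorm le_minDist_iff)

variable {m₁ n₁ m₂ n₂ : ℕ}

/-! ### Seed exchange and the sector bound -/

/-- Exchanging the two seeds exchanges `H_X` and `H_Z` up to relabelling rows and qubits:
`H_X(H₂,H₁) = H_Z(H₁,H₂)` with rows `(b,i) ↔ (i,b)` and qubits `(j,i) ↔ (i,j)`, `(b,a) ↔ (a,b)`. Proved (entrywise).
[cite: TillichZemor2014, §3 and Prop. 2 (arXiv v1 chunks p0006 L56-110)] -/
theorem HX_swap (H₁ : Matrix (Fin m₁) (Fin n₁) (ZMod 2)) (H₂ : Matrix (Fin m₂) (Fin n₂) (ZMod 2)) :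
    HX H₂ H₁ = (HZ H₁ H₂).submatrix Prod.swap (Sum.map Prod.swap Prod.swap) := by
  ext ⟨b, i⟩ (⟨j, i'⟩ | ⟨b', a⟩)
  · simp [HX, HZ, HypergraphProduct.xMatrix, HypergraphProduct.zMatrix, Matrix.kroneckerMap_apply,
      Matrix.one_apply, mul_comm]
  · simp [HX, HZ, HypergraphProduct.xMatrix, HypergraphProduct.zMatrix, Matrix.kroneckerMap_apply,
      Matrix.one_apply, mul_comm]

/-- Dually `H_Z(H₂,H₁) = H_X(H₁,H₂)` up to the same relabelling. Proved (entrywise).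
[cite: TillichZemor2014, §3 and Prop. 2 (arXiv v1 chunks p0006 L56-110)] -/
theorem HZ_swap (H₁ : Matrix (Fin m₁) (Fin n₁) (ZMod 2)) (H₂ : Matrix (Fin m₂) (Fin n₂) (ZMod 2)) :
    HZ H₂ H₁ = (HX H₁ H₂).submatrix Prod.swap (Sum.map Prod.swap Prod.swap) := by
  ext ⟨j, a⟩ (⟨j', i⟩ | ⟨b, a'⟩)
  · simp [HX, HZ, HypergraphProduct.xMatrix, HypergraphProduct.zMatrix, Matrix.kroneckerMap_apply,
      Matrix.one_apply, mul_comm]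
  · simp [HX, HZ, HypergraphProduct.xMatrix, HypergraphProduct.zMatrix, Matrix.kroneckerMap_apply,
      Matrix.one_apply, mul_comm]

/-- **The minimum distance of `HGP(H₁,H₂)` is symmetric in the two seeds** (`X ↔ Z` exchange plus relabelling).
[cite: TillichZemor2014, §4 (arXiv v1 chunk p0007 L13-15: `Q_ℋ` and the code of the dual hypergraph coincide up to `X ↔ Z`)] -/
theorem distance_swap (H₁ : Matrix (Fin m₁) (Fin n₁) (ZMod 2)) (H₂ : Matrix (Fin m₂) (Fin n₂) (ZMod 2)) :
    cssMinDist (HX H₂ H₁) (HZ H₂ H₁) = cssMinDist (HX H₁ H₂) (HZ H₁ H₂) := by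
  let κ : ((Fin n₂ × Fin n₁) ⊕ (Fin m₂ × Fin m₁)) ≃ ((Fin n₁ × Fin n₂) ⊕ (Fin m₁ × Fin m₂)) :=
    Equiv.sumCongr (Equiv.prodComm _ _) (Equiv.prodComm _ _)
  have hκ : (Sum.map Prod.swap Prod.swap : (Fin n₂ × Fin n₁) ⊕ (Fin m₂ × Fin m₁) →
      (Fin n₁ × Fin n₂) ⊕ (Fin m₁ × Fin m₂)) = κ := rfl
  rw [HX_swap H₁ H₂, HZ_swap H₁ H₂, hκ,
    show (HZ H₁ H₂).submatrix Prod.swap ⇑κ = ((HZ H₁ H₂).submatrix Prod.swap id).submatrix id κ from rfl,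
    show (HX H₁ H₂).submatrix Prod.swap ⇑κ = ((HX H₁ H₂).submatrix Prod.swap id).submatrix id κ from rfl,
    cssMinDist_submatrix_equiv,
    show (Prod.swap : Fin n₂ × Fin m₁ → Fin m₁ × Fin n₂) = Equiv.prodComm (Fin n₂) (Fin m₁) from rfl,
    show (Prod.swap : Fin m₂ × Fin n₁ → Fin n₁ × Fin m₂) = Equiv.prodComm (Fin m₂) (Fin n₁) from rfl,
    cssMinDist_submatrix_equiv_rows, cssMinDist_comm]

/-- **First seed of full row rank: `D ≥ min(d₁, d₂)`** (no transpose distances) — the sector bound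
(`Z`-type logicals weigh `≥ d₁` since `ker H₁ᵀ = 0`; `X`-type weigh `≥ min(d₂, d₁ᵀ) = d₂`).
[cite: ZengPryadko2020, Thm 17 (arXiv:2007.12152 chunk p0018 L1-12)] -/
theorem distance_ge_min_of_transpose_left (H₁ : Matrix (Fin m₁) (Fin n₁) (ZMod 2))
    (H₂ : Matrix (Fin m₂) (Fin n₂) (ZMod 2)) (h : pcCode H₁ᵀ = ⊥) :
    min (minDist (pcCode H₁)) (minDist (pcCode H₂)) ≤ cssMinDist (HX H₁ H₂) (HZ H₁ H₂) := by
  have h' := HypergraphProduct.le_cssMinDist_of_transpose H₁ H₂ᵀ h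
  rwa [Matrix.transpose_transpose] at h'

/-- **Second seed of full row rank: `D ≥ min(d₁, d₂)`**, by the seed-exchange symmetry.
[cite: ZengPryadko2020, Thm 17 (arXiv:2007.12152 chunk p0018 L1-12)] -/
theorem distance_ge_min_of_transpose_right (H₁ : Matrix (Fin m₁) (Fin n₁) (ZMod 2))
    (H₂ : Matrix (Fin m₂) (Fin n₂) (ZMod 2)) (h : pcCode H₂ᵀ = ⊥) :
    min (minDist (pcCode H₁)) (minDist (pcCode H₂)) ≤ cssMinDist (HX H₁ H₂) (HZ H₁ H₂) := by
  rw [← distance_swap, min_comm]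
  exact distance_ge_min_of_transpose_left H₂ H₁ h

/-- **`D = min(d₁, d₂)` when one seed has full row rank and both seed codes are nonzero** — the exact distance
(TZ Lemma 10 for `≤`, the sector bound for `≥`). Contains `HGP.distance_eq_min` (both seeds full rank).
[cite: ZengPryadko2020, Thm 17 (arXiv:2007.12152 chunk p0018 L1-12)] [cite: TillichZemor2014, Lemma 10 (arXiv v1 chunk p0008 L57-62)] -/
theorem distance_eq_min_of_transpose (H₁ : Matrix (Fin m₁) (Fin n₁) (ZMod 2))
    (H₂ : Matrix (Fin m₂) (Fin n₂) (ZMod 2)) (h : pcCode H₁ᵀ = ⊥ ∨ pcCode H₂ᵀ = ⊥)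
    (hd₁ : minDist (pcCode H₁) < ⊤) (hd₂ : minDist (pcCode H₂) < ⊤) :
    cssMinDist (HX H₁ H₂) (HZ H₁ H₂) = min (minDist (pcCode H₁)) (minDist (pcCode H₂)) := by
  refine le_antisymm (distance_le_min H₁ H₂ hd₁ hd₂) ?_
  rcases h with h | h
  · exact distance_ge_min_of_transpose_left H₁ H₂ h
  · exact distance_ge_min_of_transpose_right H₁ H₂ h

/-- **Census corollary, first seed of full row rank**: certificates `rank H₁ = m₁`, `rank H₂ = r₂`,
`d(ker H₁) = d₁`, `d(ker H₂) = d₂` (naturals) give `HGP(H₁,H₂) = [[n₁n₂ + m₁m₂, (n₁ − m₁)(n₂ − r₂), min(d₁,d₂)]]`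
— no transpose-distance certificate needed. The last three hypotheses are closed numeral identities (`decide`).
[cite: ZengPryadko2020, Thm 17 (arXiv:2007.12152 chunk p0018 L1-12)] [cite: TillichZemor2014, Thm 7 and Lemma 10 (arXiv v1 chunks p0007 L126-135, p0008 L57-62)] -/
theorem isCode_of_rank_left (H₁ : Matrix (Fin m₁) (Fin n₁) (ZMod 2)) (H₂ : Matrix (Fin m₂) (Fin n₂) (ZMod 2))
    {r₂ d₁ d₂ n k d : ℕ} (hr₁ : H₁.rank = m₁) (hr₂ : H₂.rank = r₂)
    (hd₁ : minDist (pcCode H₁) = d₁) (hd₂ : minDist (pcCode H₂) = d₂)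
    (hn : n₁ * n₂ + m₁ * m₂ = n) (hk : (n₁ - m₁) * (n₂ - r₂) = k) (hd : min d₁ d₂ = d) :
    (code H₁ H₂).IsCode n k d := by
  have hk' : (n₁ - m₁) * (n₂ - r₂) + (m₁ - m₁) * (m₂ - r₂) = k := by rw [Nat.sub_self, zero_mul, add_zero, hk]
  refine ⟨by rw [card_qubits, hn], by rw [code_k_eq H₁ H₂ hr₁ hr₂, hk'], ?_⟩
  rw [code_HX, code_HZ, ← hd, natCast_min_enat, ← hd₁, ← hd₂]
  exact distance_eq_min_of_transpose H₁ H₂ (Or.inl (pcCode_transpose_eq_bot_of_rank H₁ hr₁))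
    (hd₁ ▸ ENat.coe_lt_top d₁) (hd₂ ▸ ENat.coe_lt_top d₂)

/-- **Census corollary, second seed of full row rank**: certificates `rank H₁ = r₁`, `rank H₂ = m₂`,
`d(ker H₁) = d₁`, `d(ker H₂) = d₂` give `HGP(H₁,H₂) = [[n₁n₂ + m₁m₂, (n₁ − r₁)(n₂ − m₂), min(d₁,d₂)]]`.
[cite: ZengPryadko2020, Thm 17 (arXiv:2007.12152 chunk p0018 L1-12)] [cite: TillichZemor2014, Thm 7 and Lemma 10 (arXiv v1 chunks p0007 L126-135, p0008 L57-62)] -/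
theorem isCode_of_rank_right (H₁ : Matrix (Fin m₁) (Fin n₁) (ZMod 2)) (H₂ : Matrix (Fin m₂) (Fin n₂) (ZMod 2))
    {r₁ d₁ d₂ n k d : ℕ} (hr₁ : H₁.rank = r₁) (hr₂ : H₂.rank = m₂)
    (hd₁ : minDist (pcCode H₁) = d₁) (hd₂ : minDist (pcCode H₂) = d₂)
    (hn : n₁ * n₂ + m₁ * m₂ = n) (hk : (n₁ - r₁) * (n₂ - m₂) = k) (hd : min d₁ d₂ = d) :
    (code H₁ H₂).IsCode n k d := by
  have hk' : (n₁ - r₁) * (n₂ - m₂) + (m₁ - r₁) * (m₂ - m₂) = k := by rw [Nat.sub_self, mul_zero, add_zero, hk]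
  refine ⟨by rw [card_qubits, hn], by rw [code_k_eq H₁ H₂ hr₁ hr₂, hk'], ?_⟩
  rw [code_HX, code_HZ, ← hd, natCast_min_enat, ← hd₁, ← hd₂]
  exact distance_eq_min_of_transpose H₁ H₂ (Or.inr (pcCode_transpose_eq_bot_of_rank H₂ hr₂))
    (hd₁ ▸ ENat.coe_lt_top d₁) (hd₂ ▸ ENat.coe_lt_top d₂)

end Summit.Ventures.QEC.HGP
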